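import Literature.Analysis.SegalBargmann.HeisenbergRealUniquenessCoords
import HarnessLib

/-!
# Reduction of the central character: a Heisenberg group over an `ℝ`-algebra `R` with character `𝐞 ∘ ℓ` factors through a real Heisenberg group (uniqueness at complex and product places)

Topic `RepresentationTheory/HeisenbergGroup`; namespace `Literature.RepresentationTheory.HeisenbergGroup`.

The uniqueness theorem `SegalBargmann.exists_linearIsometryEquiv_of_irreducible_heisenberg` is stated for the tree's
`Heisenberg B` over the scalar ring `ℝ` with the centre `ℝ` acting by `𝐞 = e^{2πi·}`.  The Heisenberg groups at an
archimedean place (or block of places) of a number field live over `R = F_v = ℂ` or `R = F ⊗ ℝ`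
([GelbartRogawski1991, §3.1 p. 454 L17–21]: "`H(W) = W ⊕ F`", centre `F ⊗ 𝐀`) with a non-trivial continuous character
`ψ` of the centre, of the form `ψ = 𝐞 ∘ ℓ` for a non-zero real linear functional `ℓ : R → ℝ`.  This file performs the
reduction: for a commutative `ℝ`-algebra `R`, an `R`-module `X` (also an `ℝ`-module through `R`), an `R`-bilinear law
`B` and `ℓ : R →ₗ[ℝ] ℝ`:

* §1 the REAL form `realForm B ℓ = ℓ ∘ B : X →ₗ[ℝ] X →ₗ[ℝ] ℝ` and the comparison homomorphism
  `toRealHeisenberg : Heisenberg B →* Heisenberg (realForm B ℓ)`, `(v, t) ↦ (v, ℓ t)` (surjective when `ℓ` is);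
  `nondegenerate_realForm_sub_flip` (the real commutator form is non-degenerate as soon as the `R`-valued one is
  and `ℓ` detects every non-zero `r` through some multiple `c·r`);
* §2 **`pushforward`**: a representation `π` of `Heisenberg B` whose centre acts by `𝐞 ∘ ℓ` factors through
  `toRealHeisenberg` — `pushforward π r₀ ⟨v, s⟩ = π ⟨v, s • r₀⟩` for any `r₀` with `ℓ r₀ = 1`, and
  `pushforward_mk_apply : pushforward π r₀ ⟨v, ℓ t⟩ = π ⟨v, t⟩` (the kernel `{(0,t) : ℓ t = 0}` acts trivially);
* §3 **`exists_linearIsometryEquiv_of_irreducible_of_centralChar`**: if `X` is a finite-dimensional real normed space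
  and the real commutator form `ℓ(B(y,y') − B(y',y))` is non-degenerate, any two irreducible unitary representations
  of `Heisenberg B` with continuous orbit maps and central character `𝐞 ∘ ℓ` on non-zero Hilbert spaces are unitarily
  equivalent.

Everything is PROVED (Mathlib + tree); no cited statement is used as a hypothesis.

## References

* [vonNeumann1931] J. von Neumann, Die Eindeutigkeit der Schrödingerschen Operatoren, Math. Ann. 104 (1931)
  570–578.
* [Folland1989] G. B. Folland, *Harmonic Analysis in Phase Space*, Princeton University Press, 1989, §1.5
  Theorem (1.50) (doi:10.1515/9781400882427).
* [GelbartRogawski1991] S. Gelbart, J. Rogawski, Invent. Math. 105 (1991), §3.1 p. 454 L17–21.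
-/

noncomputable section

open scoped InnerProductSpace FourierTransform

namespace Literature.RepresentationTheory.HeisenbergGroup

open Literature.Analysis.SegalBargmann

variable {R : Type*} [CommRing R] [Algebra ℝ R]
variable {X : Type*} [AddCommGroup X] [Module R X] [Module ℝ X] [IsScalarTower ℝ R X]

/-! ## 1. The real form and the comparison homomorphism -/

/-- **The real form `ℓ ∘ B`** of an `R`-bilinear law, an `ℝ`-bilinear form on the underlying real vector space.
[cite: GelbartRogawski1991, §3.1 p. 454 L17–21] -/
def realForm (B : X →ₗ[R] X →ₗ[R] R) (ℓ : R →ₗ[ℝ] ℝ) : X →ₗ[ℝ] X →ₗ[ℝ] ℝ :=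
  LinearMap.mk₂ ℝ (fun x y => ℓ (B x y))
    (fun x x' y => by rw [map_add, LinearMap.add_apply, map_add])
    (fun c x y => by rw [← algebraMap_smul R c x, map_smul, LinearMap.smul_apply, algebraMap_smul, map_smul])
    (fun x y y' => by rw [map_add, map_add])
    (fun c x y => by rw [← algebraMap_smul R c y, map_smul, algebraMap_smul, map_smul])

/-- unfolding. [cite: GelbartRogawski1991, §3.1 p. 454 L17–21] -/
@[simp] theorem realForm_apply (B : X →ₗ[R] X →ₗ[R] R) (ℓ : R →ₗ[ℝ] ℝ) (x y : X) :
    realForm B ℓ x y = ℓ (B x y) := rfl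

/-- **The comparison homomorphism** `(v, t) ↦ (v, ℓ t)` from `Heisenberg B` to the real Heisenberg group of `ℓ ∘ B`.
[cite: GelbartRogawski1991, §3.1 p. 454 L17–21] -/
def toRealHeisenberg (B : X →ₗ[R] X →ₗ[R] R) (ℓ : R →ₗ[ℝ] ℝ) : Heisenberg B →* Heisenberg (realForm B ℓ) where
  toFun h := ⟨h.v, ℓ h.t⟩
  map_one' := by
    ext
    · rfl
    · change ℓ 0 = 0
      rw [map_zero]
  map_mul' a b := by
    ext
    · rfl
    · change ℓ (a.t + b.t + B a.v b.v) = ℓ a.t + ℓ b.t + realForm B ℓ a.v b.v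
      rw [map_add, map_add, realForm_apply]

/-- unfolding. [cite: GelbartRogawski1991, §3.1 p. 454 L17–21] -/
@[simp] theorem toRealHeisenberg_apply (B : X →ₗ[R] X →ₗ[R] R) (ℓ : R →ₗ[ℝ] ℝ) (h : Heisenberg B) :
    toRealHeisenberg B ℓ h = ⟨h.v, ℓ h.t⟩ := rfl


/-- **Non-degeneracy of the real commutator form** from that of the `R`-valued one: if `ℓ ∘ (c ↦ c·r)` detects every
`r ≠ 0` (e.g. `ℓ` a trace form of an étale `ℝ`-algebra, `ℓ = Re` on `ℂ`) and `B(x,·) − B(·,x)` detects every `x ≠ 0`,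
then `ℓ(B(y,y') − B(y',y))` is non-degenerate. [cite: GelbartRogawski1991, §3.1 p. 454 L17–21] -/
theorem nondegenerate_realForm_sub_flip (B : X →ₗ[R] X →ₗ[R] R) (ℓ : R →ₗ[ℝ] ℝ)
    (hℓ : ∀ r : R, r ≠ 0 → ∃ c : R, ℓ (c * r) ≠ 0) (hs : ∀ x : X, x ≠ 0 → ∃ y : X, B x y - B y x ≠ 0) :
    (realForm B ℓ - (realForm B ℓ).flip).Nondegenerate := by
  have key : ∀ x : X, (∀ y : X, (realForm B ℓ - (realForm B ℓ).flip) x y = 0) → x = 0 := by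
    intro x hx
    by_contra hx0
    obtain ⟨y, hy⟩ := hs x hx0
    obtain ⟨c, hc⟩ := hℓ _ hy
    apply hc
    have h := hx (c • y)
    simp only [LinearMap.sub_apply, LinearMap.flip_apply, realForm_apply, map_smul, LinearMap.smul_apply,
      smul_eq_mul] at h
    rwa [← map_sub, ← mul_sub] at h
  refine ⟨?_, ?_⟩
  · intro x hx
    exact key x hx
  · intro y hy
    refine key y fun x => ?_
    have h := hy x
    simp only [LinearMap.sub_apply, LinearMap.flip_apply] at h ⊢
    linarith

/-! ## 2. Factorisation of a representation with central character `𝐞 ∘ ℓ` -/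

section Pushforward

variable {E : Type*} [AddCommGroup E] [Module ℂ E]
variable (B : X →ₗ[R] X →ₗ[R] R) (ℓ : R →ₗ[ℝ] ℝ) (π : Representation ℂ (Heisenberg B) E) (r₀ : R)

omit [Module ℝ X] [IsScalarTower ℝ R X] in
/-- A central element on which `ℓ` vanishes acts trivially when the central character is `𝐞 ∘ ℓ`.
[cite: Folland1989, §1.5 Theorem (1.50)] -/
theorem apply_mk_zero_of_eq_zero
    (hπz : ∀ (t : R) (v : E), π (Heisenberg.ofCenter B (Multiplicative.ofAdd t)) v = ((𝐞 (ℓ t) : Circle) : ℂ) • v)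
    {t : R} (ht : ℓ t = 0) (v : E) : π ⟨0, t⟩ v = v := by
  have h := hπz t v
  rw [ht, AddChar.map_zero_eq_one, Circle.coe_one, one_smul] at h
  exact h

omit [Module ℝ X] [IsScalarTower ℝ R X] in
/-- `π (v, t)` depends on `t` only through `ℓ t`. [cite: Folland1989, §1.5 Theorem (1.50)] -/
theorem apply_mk_eq_of_ell_eq
    (hπz : ∀ (t : R) (v : E), π (Heisenberg.ofCenter B (Multiplicative.ofAdd t)) v = ((𝐞 (ℓ t) : Circle) : ℂ) • v)
    (x : X) {t t' : R} (ht : ℓ t = ℓ t') (v : E) : π ⟨x, t⟩ v = π ⟨x, t'⟩ v := by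
  have hfac : (⟨x, t⟩ : Heisenberg B) = ⟨x, t'⟩ * ⟨0, t - t'⟩ := by
    ext
    · simp
    · simp only [Heisenberg.mk_mul_mk, map_zero]
      ring
  rw [hfac, map_mul, Module.End.mul_apply, apply_mk_zero_of_eq_zero B ℓ π hπz (by rw [map_sub, ht, sub_self])]

/-- **The factorisation** of a representation with central character `𝐞 ∘ ℓ` through the real Heisenberg group:
`pushforward π r₀ ⟨v, s⟩ = π ⟨v, s • r₀⟩` for a chosen `r₀` with `ℓ r₀ = 1`. [cite: Folland1989, §1.5 Theorem (1.50)] -/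
def pushforward
    (hπz : ∀ (t : R) (v : E), π (Heisenberg.ofCenter B (Multiplicative.ofAdd t)) v = ((𝐞 (ℓ t) : Circle) : ℂ) • v)
    (hr₀ : ℓ r₀ = 1) : Representation ℂ (Heisenberg (realForm B ℓ)) E where
  toFun h := π ⟨h.v, h.t • r₀⟩
  map_one' := by
    change π ⟨(1 : Heisenberg (realForm B ℓ)).v, (1 : Heisenberg (realForm B ℓ)).t • r₀⟩ = 1
    rw [Heisenberg.one_v, Heisenberg.one_t, zero_smul, ← Heisenberg.one_def, map_one]
  map_mul' a b := by
    apply LinearMap.ext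
    intro v
    change π ⟨a.v + b.v, (a.t + b.t + ℓ (B a.v b.v)) • r₀⟩ v = π ⟨a.v, a.t • r₀⟩ (π ⟨b.v, b.t • r₀⟩ v)
    rw [← Module.End.mul_apply, ← map_mul, Heisenberg.mk_mul_mk]
    refine apply_mk_eq_of_ell_eq B ℓ π hπz _ ?_ v
    rw [map_smul, map_add, map_add, map_smul, map_smul, smul_eq_mul, smul_eq_mul, smul_eq_mul, hr₀]
    ring

/-- unfolding. [cite: Folland1989, §1.5 Theorem (1.50)] -/
theorem pushforward_apply
    (hπz : ∀ (t : R) (v : E), π (Heisenberg.ofCenter B (Multiplicative.ofAdd t)) v = ((𝐞 (ℓ t) : Circle) : ℂ) • v)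
    (hr₀ : ℓ r₀ = 1) (h : Heisenberg (realForm B ℓ)) (v : E) :
    pushforward B ℓ π r₀ hπz hr₀ h v = π ⟨h.v, h.t • r₀⟩ v := rfl

/-- **`π = pushforward π ∘ toRealHeisenberg`**: `pushforward π r₀ ⟨x, ℓ t⟩ = π ⟨x, t⟩`.
[cite: Folland1989, §1.5 Theorem (1.50)] -/
theorem pushforward_toRealHeisenberg_apply
    (hπz : ∀ (t : R) (v : E), π (Heisenberg.ofCenter B (Multiplicative.ofAdd t)) v = ((𝐞 (ℓ t) : Circle) : ℂ) • v)
    (hr₀ : ℓ r₀ = 1) (h : Heisenberg B) (v : E) :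
    pushforward B ℓ π r₀ hπz hr₀ (toRealHeisenberg B ℓ h) v = π h v := by
  rw [pushforward_apply, toRealHeisenberg_apply]
  exact apply_mk_eq_of_ell_eq B ℓ π hπz _ (by rw [map_smul, smul_eq_mul, hr₀, mul_one]) v

/-- `pushforward π ⟨x, 0⟩ = π ⟨x, 0⟩`. [cite: Folland1989, §1.5 Theorem (1.50)] -/
theorem pushforward_mk_zero_apply
    (hπz : ∀ (t : R) (v : E), π (Heisenberg.ofCenter B (Multiplicative.ofAdd t)) v = ((𝐞 (ℓ t) : Circle) : ℂ) • v)
    (hr₀ : ℓ r₀ = 1) (x : X) (v : E) : pushforward B ℓ π r₀ hπz hr₀ ⟨x, 0⟩ v = π ⟨x, 0⟩ v := by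
  rw [pushforward_apply, zero_smul]

/-- the centre of the real Heisenberg group acts by `𝐞` on the pushforward. [cite: Folland1989, §1.5 Theorem (1.50)] -/
theorem pushforward_center
    (hπz : ∀ (t : R) (v : E), π (Heisenberg.ofCenter B (Multiplicative.ofAdd t)) v = ((𝐞 (ℓ t) : Circle) : ℂ) • v)
    (hr₀ : ℓ r₀ = 1) (s : ℝ) (v : E) :
    pushforward B ℓ π r₀ hπz hr₀ (Heisenberg.ofCenter (realForm B ℓ) (Multiplicative.ofAdd s)) v =
      ((𝐞 s : Circle) : ℂ) • v := by
  change π ⟨0, s • r₀⟩ v = _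
  have e : ℓ (s • r₀) = s := by rw [ℓ.map_smul, smul_eq_mul, hr₀, mul_one]
  have h := hπz (s • r₀) v
  rw [e] at h
  exact h

end Pushforward

/-! ## 3. Uniqueness for central character `𝐞 ∘ ℓ` -/

section Unique

variable {X : Type*} [NormedAddCommGroup X] [NormedSpace ℝ X] [FiniteDimensional ℝ X] [Module R X]
  [IsScalarTower ℝ R X]

/-- **Stone–von Neumann uniqueness for a Heisenberg group over an `ℝ`-algebra with central character `𝐞 ∘ ℓ`**: if the
real commutator form `ℓ(B(y,y') − B(y',y))` is non-degenerate on the finite-dimensional real normed space `X`, any two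
irreducible unitary representations of `Heisenberg B` with continuous orbit maps `y ↦ π(y,0)v` and central character
`𝐞 ∘ ℓ` on non-zero Hilbert spaces are unitarily equivalent (pushforward to the real Heisenberg group of `ℓ ∘ B` and
`SegalBargmann.exists_linearIsometryEquiv_of_irreducible_heisenberg`).
[cite: vonNeumann1931, §4; Folland1989, §1.5 Theorem (1.50)] -/
theorem exists_linearIsometryEquiv_of_irreducible_of_centralChar (B : X →ₗ[R] X →ₗ[R] R) (ℓ : R →ₗ[ℝ] ℝ)
    (hℓ : Function.Surjective ℓ) (hs : (realForm B ℓ - (realForm B ℓ).flip).Nondegenerate)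
    {E₁ : Type*} [NormedAddCommGroup E₁] [InnerProductSpace ℂ E₁] [CompleteSpace E₁] [Nontrivial E₁]
    {E₂ : Type*} [NormedAddCommGroup E₂] [InnerProductSpace ℂ E₂] [CompleteSpace E₂] [Nontrivial E₂]
    (π₁ : Representation ℂ (Heisenberg B) E₁) (π₂ : Representation ℂ (Heisenberg B) E₂)
    (h₁u : ∀ (h : Heisenberg B) (v : E₁), ‖π₁ h v‖ = ‖v‖) (h₂u : ∀ (h : Heisenberg B) (v : E₂), ‖π₂ h v‖ = ‖v‖)
    (h₁c : ∀ v : E₁, Continuous fun y : X => π₁ ⟨y, 0⟩ v)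
    (h₂c : ∀ v : E₂, Continuous fun y : X => π₂ ⟨y, 0⟩ v)
    (h₁z : ∀ (t : R) (v : E₁), π₁ (Heisenberg.ofCenter B (Multiplicative.ofAdd t)) v =
      ((𝐞 (ℓ t) : Circle) : ℂ) • v)
    (h₂z : ∀ (t : R) (v : E₂), π₂ (Heisenberg.ofCenter B (Multiplicative.ofAdd t)) v =
      ((𝐞 (ℓ t) : Circle) : ℂ) • v)
    (h₁i : ∀ K : Submodule ℂ E₁, IsClosed (K : Set E₁) → (∀ (h : Heisenberg B), ∀ v ∈ K, π₁ h v ∈ K) →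
      K = ⊥ ∨ K = ⊤)
    (h₂i : ∀ K : Submodule ℂ E₂, IsClosed (K : Set E₂) → (∀ (h : Heisenberg B), ∀ v ∈ K, π₂ h v ∈ K) →
      K = ⊥ ∨ K = ⊤) :
    ∃ U : E₁ ≃ₗᵢ[ℂ] E₂, ∀ (h : Heisenberg B) (v : E₁), U (π₁ h v) = π₂ h (U v) := by
  obtain ⟨r₀, hr₀⟩ := hℓ 1
  set ρ₁ := pushforward B ℓ π₁ r₀ h₁z hr₀ with hρ₁
  set ρ₂ := pushforward B ℓ π₂ r₀ h₂z hr₀ with hρ₂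
  have hsurj : Function.Surjective (toRealHeisenberg B ℓ) := fun h => by
    obtain ⟨t, ht⟩ := hℓ h.t
    exact ⟨⟨h.v, t⟩, by rw [toRealHeisenberg_apply, ht]⟩
  obtain ⟨U, hU⟩ := exists_linearIsometryEquiv_of_irreducible_heisenberg (realForm B ℓ) hs ρ₁ ρ₂
    (fun h v => by
      obtain ⟨h', rfl⟩ := hsurj h
      rw [hρ₁, pushforward_toRealHeisenberg_apply, h₁u])
    (fun h v => by
      obtain ⟨h', rfl⟩ := hsurj h
      rw [hρ₂, pushforward_toRealHeisenberg_apply, h₂u])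
    (fun v => by simp only [hρ₁, pushforward_mk_zero_apply]; exact h₁c v)
    (fun v => by simp only [hρ₂, pushforward_mk_zero_apply]; exact h₂c v)
    (pushforward_center B ℓ π₁ r₀ h₁z hr₀) (pushforward_center B ℓ π₂ r₀ h₂z hr₀)
    (fun K hKc hK => h₁i K hKc fun h v hv => by
      rw [← pushforward_toRealHeisenberg_apply B ℓ π₁ r₀ h₁z hr₀]
      exact hK _ v hv)
    (fun K hKc hK => h₂i K hKc fun h v hv => by
      rw [← pushforward_toRealHeisenberg_apply B ℓ π₂ r₀ h₂z hr₀]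
      exact hK _ v hv)
  refine ⟨U, fun h v => ?_⟩
  rw [← pushforward_toRealHeisenberg_apply B ℓ π₁ r₀ h₁z hr₀, ← pushforward_toRealHeisenberg_apply B ℓ π₂ r₀ h₂z hr₀]
  exact hU _ v

end Unique

end Literature.RepresentationTheory.HeisenbergGroup

end
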